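import Mathlib
import Summits.AtomisticToContinuum.Crystallization.Theorems.ExcessDecayLiouvillePhononStabilityCertGramSlot

/-!
# Polynomial pair forms: data-backed matrices, monomials, polynomial tables, scalar polynomials

Support file for the crux `PhononStability` (line contragredient-window-collapse), namespace
`…PhononStabilityCWC.Cert`.
-/

noncomputable section

open scoped BigOperators Classical InnerProductSpace
open Filter Set Function
open Summit.AtomisticToContinuum.Crystallization.Theorems.PhononStabilityNegative

namespace Summit.AtomisticToContinuum.Crystallization.Theorems.PhononStabilityCWC.Cert

local notation "E3" => EuclideanSpace ℝ (Fin 3)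


/-! ## Data-backed 3×3 matrices

`mat9` (Table file) materialises through `let`s, which the compiler floats under the binder, so a chain of
`k` merges costs `9^k` entry evaluations at run time.  `M9` is a first-order record: `M9.get m` is a closure
over evaluated data, so entry access is `O(1)` however the matrix was built. -/

/-- a 3×3 rational matrix as a record -/
structure M9 where
  /-- entry -/ a00 : ℚ
  /-- entry -/ a01 : ℚ
  /-- entry -/ a02 : ℚ
  /-- entry -/ a10 : ℚ
  /-- entry -/ a11 : ℚ
  /-- entry -/ a12 : ℚ
  /-- entry -/ a20 : ℚ
  /-- entry -/ a21 : ℚ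
  /-- entry -/ a22 : ℚ

namespace M9

/-- the matrix of a record -/
@[noinline] def get (m : M9) : Mat := fun i j =>
  match i, j with
  | 0, 0 => m.a00 | 0, 1 => m.a01 | 0, 2 => m.a02
  | 1, 0 => m.a10 | 1, 1 => m.a11 | 1, 2 => m.a12
  | 2, 0 => m.a20 | 2, 1 => m.a21 | 2, 2 => m.a22

/-- the record of a matrix (evaluates the nine entries now) -/
@[noinline] def ofMat (Q : Mat) : M9 := ⟨Q 0 0, Q 0 1, Q 0 2, Q 1 0, Q 1 1, Q 1 2, Q 2 0, Q 2 1, Q 2 2⟩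

/-- round trip. [folklore] -/
theorem get_ofMat (Q : Mat) : (ofMat Q).get = Q := by
  funext i j
  fin_cases i <;> fin_cases j <;> rfl

/-- entrywise sum of two matrices as a record -/
@[noinline] def addMat (M N : Mat) : M9 :=
  ⟨M 0 0 + N 0 0, M 0 1 + N 0 1, M 0 2 + N 0 2, M 1 0 + N 1 0, M 1 1 + N 1 1, M 1 2 + N 1 2,
    M 2 0 + N 2 0, M 2 1 + N 2 1, M 2 2 + N 2 2⟩

/-- the sum record is the sum. [folklore] -/
theorem get_addMat (M N : Mat) : (addMat M N).get = fun i j => M i j + N i j := by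
  funext i j
  fin_cases i <;> fin_cases j <;> rfl

end M9

/-- Merge adjacent entries with equal class, materialising sums as records (linear-time entry access). -/
def mergeAdj3 : TPTable → TPTable
  | [] => []
  | [e] => [e]
  | e :: f :: rest =>
      if e.1 = f.1 then mergeAdj3 ((e.1, (M9.addMat e.2 f.2).get) :: rest) else e :: mergeAdj3 (f :: rest)
  termination_by T => T.length

/-- Canonical form by the total order with record-materialised merging. -/
def canon3 (T : TPTable) : TPTable := mergeAdj3 ((T.map orient2).mergeSort fun a b => keyLE2 a.1 b.1)

/-- merging preserves evaluation. [folklore] -/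
theorem tpEval_mergeAdj3 {w : Label → E3} (hw : (support w).Finite) (T : TPTable) :
    tpEval (mergeAdj3 T) w = tpEval T w := by
  induction hn : T.length using Nat.strong_induction_on generalizing T with
  | _ n ih =>
    match T, hn with
    | [], _ => simp [mergeAdj3]
    | [e], _ => simp [mergeAdj3]
    | e :: f :: rest, hn =>
        rw [mergeAdj3]
        split_ifs with h
        · rw [ih _ (by simp at hn ⊢; omega) _ rfl, tpEval_cons, tpEval_cons, tpEval_cons, M9.get_addMat]
          obtain ⟨ke, Me⟩ := e
          obtain ⟨kf, Mf⟩ := f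
          simp only at h
          subst h
          rw [tpEntry_add hw]
          ring
        · rw [tpEval_cons, tpEval_cons, ih _ (by simp at hn ⊢; omega) _ rfl, tpEval_cons]

/-- **Canonical form (records) preserves evaluation.** -/
theorem tpEval_canon3 {w : Label → E3} (hw : (support w).Finite) (T : TPTable) :
    tpEval (canon3 T) w = tpEval T w := by
  unfold canon3
  rw [tpEval_mergeAdj3 hw, tpEval_perm (List.mergeSort_perm _ _)]
  unfold tpEval
  rw [List.map_map]
  congr 1
  exact List.map_congr_left fun e _ => tpEval_orient2 w e

/-! ## Polynomial layer: monomials, polynomial pair forms -/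

/-- Monomials: sorted lists of variable indices (the empty list is the constant monomial). -/
abbrev Mono := List ℕ

/-- Value of a monomial at an assignment `x : ℕ → ℝ`. -/
def monoVal (x : ℕ → ℝ) (m : Mono) : ℝ := (m.map x).prod

/-- Product of monomials (sorted merge). -/
def monoMul (a b : Mono) : Mono := (a ++ b).mergeSort

/-- monomial values are multiplicative. [folklore] -/
theorem monoVal_monoMul (x : ℕ → ℝ) (a b : Mono) : monoVal x (monoMul a b) = monoVal x a * monoVal x b := by
  unfold monoVal monoMul
  rw [((List.mergeSort_perm (a ++ b) (· ≤ ·)).map x).prod_eq, List.map_append, List.prod_append]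

/-- Polynomial pair forms: two-point tables attached to monomials. -/
abbrev PolyPF := List (Mono × TPTable)

/-- Evaluation of a polynomial pair form. -/
def evalPPF (P : PolyPF) (x : ℕ → ℝ) (w : Label → E3) : ℝ := (P.map fun e => monoVal x e.1 * tpEval e.2 w).sum

/-- Scalar polynomials. -/
abbrev SPoly := List (Mono × ℚ)

/-- Evaluation of a scalar polynomial. -/
def spEval (p : SPoly) (x : ℕ → ℝ) : ℝ := (p.map fun e => monoVal x e.1 * (e.2 : ℝ)).sum

/-- Scaling a table. -/
def smulT (c : ℚ) (T : TPTable) : TPTable := T.map fun e => (e.1, fun a b => c * e.2 a b)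

/-- `bil` of a scaled matrix. [folklore] -/
theorem bil_smul (c : ℚ) (M : Mat) (u v : Fin 3 → ℝ) : bil (fun a b => c * M a b) u v = c * bil M u v := by
  simp only [bil, Rat.cast_mul, Finset.mul_sum]
  refine Finset.sum_congr rfl fun i _ => Finset.sum_congr rfl fun j _ => ?_
  ring

/-- evaluation of a scaled table. [folklore] -/
theorem tpEval_smulT (c : ℚ) (T : TPTable) (w : Label → E3) : tpEval (smulT c T) w = c * tpEval T w := by
  induction T with
  | nil => simp [smulT, tpEval]
  | cons e rest ih =>
      simp only [smulT, List.map_cons, tpEval_cons] at ih ⊢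
      rw [ih, mul_add]
      congr 1
      simp only [tpEntry, bil_smul]
      exact tsum_mul_left

/-- evaluation of the empty polynomial pair form. [folklore] -/
@[simp] theorem evalPPF_nil (x : ℕ → ℝ) (w : Label → E3) : evalPPF [] x w = 0 := rfl

/-- evaluation of a cons. [folklore] -/
@[simp] theorem evalPPF_cons (e : Mono × TPTable) (P : PolyPF) (x : ℕ → ℝ) (w : Label → E3) :
    evalPPF (e :: P) x w = monoVal x e.1 * tpEval e.2 w + evalPPF P x w := by
  simp [evalPPF]

/-- evaluation is additive under concatenation. [folklore] -/
theorem evalPPF_append (P Q : PolyPF) (x : ℕ → ℝ) (w : Label → E3) :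
    evalPPF (P ++ Q) x w = evalPPF P x w + evalPPF Q x w := by
  simp [evalPPF, List.map_append, List.sum_append]

/-- evaluation of a flat-mapped polynomial pair form. [folklore] -/
theorem evalPPF_flatMap {ι : Type*} (l : List ι) (f : ι → PolyPF) (x : ℕ → ℝ) (w : Label → E3) :
    evalPPF (l.flatMap f) x w = (l.map fun i => evalPPF (f i) x w).sum := by
  induction l with
  | nil => rfl
  | cons a rest ih => simp [List.flatMap_cons, evalPPF_append, ih]

/-- Product of a scalar polynomial with a polynomial pair form. -/
def mulSP (p : SPoly) (P : PolyPF) : PolyPF := p.flatMap fun e => P.map fun f => (monoMul e.1 f.1, smulT e.2 f.2)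

/-- evaluation of a monomial multiple. [folklore] -/
theorem evalPPF_map_smul (e : Mono × ℚ) (P : PolyPF) (x : ℕ → ℝ) (w : Label → E3) :
    evalPPF (P.map fun f => (monoMul e.1 f.1, smulT e.2 f.2)) x w = monoVal x e.1 * (e.2 : ℝ) * evalPPF P x w := by
  induction P with
  | nil => simp
  | cons f rest ih =>
      simp only [List.map_cons, evalPPF_cons, ih, monoVal_monoMul, tpEval_smulT]
      ring

/-- evaluation of a scalar-polynomial multiple. [folklore] -/
theorem evalPPF_mulSP (p : SPoly) (P : PolyPF) (x : ℕ → ℝ) (w : Label → E3) :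
    evalPPF (mulSP p P) x w = spEval p x * evalPPF P x w := by
  unfold mulSP spEval
  induction p with
  | nil => simp [evalPPF]
  | cons e rest ih =>
      simp only [List.flatMap_cons, evalPPF_append, ih, List.map_cons, List.sum_cons, evalPPF_map_smul]
      ring

/-- Negation of a polynomial pair form. -/
def negPPF (P : PolyPF) : PolyPF := P.map fun f => (f.1, smulT (-1) f.2)

/-- evaluation of the negation. [folklore] -/
theorem evalPPF_negPPF (P : PolyPF) (x : ℕ → ℝ) (w : Label → E3) : evalPPF (negPPF P) x w = -evalPPF P x w := by
  unfold negPPF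
  induction P with
  | nil => simp
  | cons f rest ih =>
      simp only [List.map_cons, evalPPF_cons, ih, tpEval_smulT]
      push_cast; ring

/-! ## Scalar polynomial utilities -/

/-- evaluation of the zero scalar polynomial. [folklore] -/
@[simp] theorem spEval_nil (x : ℕ → ℝ) : spEval [] x = 0 := rfl

/-- evaluation of a cons. [folklore] -/
@[simp] theorem spEval_cons (e : Mono × ℚ) (p : SPoly) (x : ℕ → ℝ) :
    spEval (e :: p) x = monoVal x e.1 * (e.2 : ℝ) + spEval p x := by
  simp [spEval]

/-- evaluation is additive under concatenation. [folklore] -/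
theorem spEval_append (p q : SPoly) (x : ℕ → ℝ) : spEval (p ++ q) x = spEval p x + spEval q x := by
  simp [spEval, List.map_append, List.sum_append]

/-- product of scalar polynomials -/
def spMul (p q : SPoly) : SPoly := p.flatMap fun e => q.map fun f => (monoMul e.1 f.1, e.2 * f.2)

/-- evaluation of a monomial multiple. [folklore] -/
theorem spEval_map_mul (e : Mono × ℚ) (q : SPoly) (x : ℕ → ℝ) :
    spEval (q.map fun f => (monoMul e.1 f.1, e.2 * f.2)) x = monoVal x e.1 * (e.2 : ℝ) * spEval q x := by
  induction q with
  | nil => simp [spEval]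
  | cons f qrest ih =>
      simp only [List.map_cons, spEval_cons, ih, monoVal_monoMul, Rat.cast_mul, mul_add]
      ring

/-- evaluation of a product. [folklore] -/
theorem spEval_spMul (p q : SPoly) (x : ℕ → ℝ) : spEval (spMul p q) x = spEval p x * spEval q x := by
  unfold spMul
  induction p with
  | nil => simp [spEval]
  | cons e rest ih =>
      simp only [List.flatMap_cons, spEval_append, ih, spEval_cons, add_mul, spEval_map_mul]

/-- lexicographic order of monomials -/
def monoLE : Mono → Mono → Bool
  | [], _ => true
  | _ :: _, [] => false
  | a :: p, b :: q => if a < b then true else if b < a then false else monoLE p q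

/-- merge adjacent terms with equal monomials (input meant to be sorted) -/
def spMergeAdj : SPoly → SPoly
  | [] => []
  | [e] => [e]
  | e :: f :: rest => if e.1 = f.1 then spMergeAdj ((e.1, e.2 + f.2) :: rest) else e :: spMergeAdj (f :: rest)
  termination_by p => p.length

/-- normal form of a scalar polynomial: sort by monomial, collect equal monomials, drop zero terms (`O(n log n)`) -/
def spNorm (p : SPoly) : SPoly := (spMergeAdj (p.mergeSort fun a b => monoLE a.1 b.1)).filter fun e => e.2 ≠ 0

/-- merging adjacent equal monomials preserves evaluation. [folklore] -/
theorem spEval_spMergeAdj (x : ℕ → ℝ) (p : SPoly) : spEval (spMergeAdj p) x = spEval p x := by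
  induction hn : p.length using Nat.strong_induction_on generalizing p with
  | _ n ih =>
    match p, hn with
    | [], _ => simp [spMergeAdj]
    | [e], _ => simp [spMergeAdj]
    | e :: f :: rest, hn =>
        rw [spMergeAdj]
        split_ifs with h
        · rw [ih _ (by simp at hn ⊢; omega) _ rfl, spEval_cons, spEval_cons, spEval_cons]
          obtain ⟨me, ce⟩ := e
          obtain ⟨mf, cf⟩ := f
          simp only at h
          subst h
          push_cast
          ring
        · rw [spEval_cons, spEval_cons, ih _ (by simp at hn ⊢; omega) _ rfl, spEval_cons]

/-- dropping zero terms preserves evaluation. [folklore] -/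
theorem spEval_filter_ne_zero (p : SPoly) (x : ℕ → ℝ) : spEval (p.filter fun e => e.2 ≠ 0) x = spEval p x := by
  induction p with
  | nil => rfl
  | cons e rest ih =>
      rw [List.filter_cons]
      split_ifs with h
      · rw [spEval_cons, spEval_cons, ih]
      · rw [spEval_cons, ih]
        simp only [ne_eq, decide_not, Bool.not_eq_eq_eq_not, Bool.not_true, decide_eq_false_iff_not,
          Decidable.not_not] at h
        rw [h]; push_cast; ring

/-- **normalisation preserves evaluation.** [folklore] -/
theorem spEval_spNorm (p : SPoly) (x : ℕ → ℝ) : spEval (spNorm p) x = spEval p x := by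
  unfold spNorm
  rw [spEval_filter_ne_zero, spEval_spMergeAdj]
  unfold spEval
  exact ((List.mergeSort_perm _ _).map _).sum_eq

/-- normalised product of scalar polynomials -/
def spMulN (p q : SPoly) : SPoly := spNorm (spMul p q)

/-- evaluation of the normalised product. [folklore] -/
theorem spEval_spMulN (p q : SPoly) (x : ℕ → ℝ) : spEval (spMulN p q) x = spEval p x * spEval q x := by
  unfold spMulN; rw [spEval_spNorm, spEval_spMul]


/-- Anchor of this support file (registered stub of the line skeleton). -/
theorem stub_certPolyA : ∀ (T : TPTable) (w : Label → EuclideanSpace ℝ (Fin 3)), (Function.support w).Finite →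
    tpEval (canon3 T) w = tpEval T w :=
  fun T _ hw => tpEval_canon3 hw T

end Summit.AtomisticToContinuum.Crystallization.Theorems.PhononStabilityCWC.Cert

end
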